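import Literature.Algebra.Homology.HomAcyclicComplexExact
import Literature.Algebra.Homology.LeftExactAcyclicClass
import Mathlib.Algebra.Homology.HomotopyCategory.Acyclic
import Mathlib.Algebra.Homology.HomotopyCategory.HomComplex
import Mathlib.Algebra.Homology.HomotopyCategory.Pretriangulated
import Mathlib.Algebra.Homology.HomotopyCategory.Shift
import Mathlib.Algebra.Homology.DerivedCategory.KInjective
import Mathlib.Algebra.Homology.DerivedCategory.DerivabilityStructureInjectives
import Mathlib.Algebra.Homology.DerivedCategory.Linear
import HarnessLib

/-!
# Maps from a bounded complex of `Ext`-acyclic objects: null-homotopies, and `Hom_K = Hom_D`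
# (the non-K-injective half of "derived functors via acyclic resolutions"; Hartshorne III.1.2A,
# Spaltenstein Prop. 1.5, Lipman Prop. 3.2.3 / Stacks 0DVC in the acyclic-target form)

Let `𝒜` be an abelian category, `M•` a BOUNDED cochain complex and `N•` a BOUNDED-BELOW cochain
complex such that every term of `M•` is `Hom(–, Nⁿ)`-acyclic for every term of `N•`:
`Extⁱ(Mᵖ, Nⁿ) = 0` for all `i ≥ 1`, `p`, `n`. The typical case (the reason this file exists, Road №4
of the Hodge atlas): `Mᵖ` vector bundles and `Nⁿ = g_*Iⁿ` direct images of injective modules along a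
morphism of schemes (`𝓗om(Mᵖ, g_*Iⁿ)` is flasque). Then:

* `nullHomotopic_of_acyclic_of_ext_subsingleton` — if moreover `N• = C•` is ACYCLIC, every chain map
  `M• → C•` is null-homotopic. Proof: the descending construction of a null-homotopy `(hᵖ)`; the
  obstruction to defining `hᵖ⁻¹` is a cycle of the complex `Hom(Mᵖ⁻¹, C•)`, which is exact
  (`Algebra/Homology/HomAcyclicComplexExact`, Hartshorne III.1.2A ∕ Weibel Cor. 5.7.7).
* `subsingleton_quotient_hom_of_acyclic_of_ext_subsingleton` — hence `Hom_{K(𝒜)}(M•, C•) = 0`.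
* `Qh_map_bijective_of_ext_subsingleton` — for `N•` as above (not necessarily acyclic) and `𝒜` with
  enough injectives, the localisation functor `Qh : K(𝒜) → D(𝒜)` is BIJECTIVE on `Hom_K(M•, N•)`:
  choose an injective resolution `ρ : N• → J•` (Mathlib `CochainComplex.Plus.exists_quasiIso_injective`);
  the cone of `ρ` is acyclic, bounded below, with terms `Nⁿ⁺¹ ⊞ Jⁿ` again `Hom(Mᵖ, –)`-acyclic, so
  `Hom_K(M•, Cone(ρ)⟦j⟧) = 0` and `Hom_K(M•, N•) ≅ Hom_K(M•, J•)` (long exact sequence of the cone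
  triangle), while `Hom_K(M•, J•) = Hom_D(M•, J•) = Hom_D(M•, N•)` (`J•` is K-injective, Mathlib
  `CochainComplex.IsKInjective.Qh_map_bijective`; `Q ρ` is an isomorphism). This is the statement
  "`Hom_D(M•, N•)` may be computed on the `Hom(M•, –)`-acyclic complex `N•` itself" — Spaltenstein's
  Prop. 1.5 / Lipman's Prop. 3.2.3 with the K-injective target replaced by an acyclic one.
* `homLinearEquivQOfExtVanishing` — the same as a `𝕜`-linear equivalence
  `Hom_{K(𝒜)}(M•, N•) ≃ₗ[𝕜] Hom_{D(𝒜)}(Q M•, Q N•)` (twin of the tree's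
  `IsKInjective.homLinearEquivQ`, `Algebra/Homology/KInjectiveAdjunction`).

Everything is proved; no named facts.

## References

* R. Hartshorne, *Algebraic Geometry*, GTM 52 (1977), III Prop. 1.2A, III Prop. 6.5
  (Ext via acyclic resolutions). [Hartshorne1977]
* N. Spaltenstein, *Resolutions of unbounded complexes*, Compositio Math. 65 (1988), Prop. 1.5.
  [Spaltenstein1988]
* J. Lipman, *Notes on derived functors and Grothendieck duality*, LNM 1960 (2009), Prop. 3.2.3.
  [Lipman2009]
* C. A. Weibel, *An introduction to homological algebra* (1994), Cor. 5.7.7, §10.4 (Cor. 10.4.7).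
  [Weibel1994]
-/

noncomputable section

open CategoryTheory CategoryTheory.Limits CategoryTheory.Abelian CategoryTheory.Pretriangulated
open CochainComplex CochainComplex.HomComplex

universe w w' v u

namespace Literature.Algebra.Homology

variable {C : Type u} [Category.{v} C] [Abelian C]

/-! ### Null-homotopies into acyclic complexes of `Hom(Mᵖ, –)`-acyclic objects -/

section NullHomotopic

variable [HasExt.{w} C] {M K : CochainComplex C ℤ} (f : M ⟶ K)

/-- The homotopy equation in degree `p` for a family `η = (ηᵖ : Mᵖ → Kᵖ⁻¹)`:
`fᵖ = d ηᵖ⁺¹ + ηᵖ d`. [folklore] -/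
private def HEq' (η : ∀ p : ℤ, M.X p ⟶ K.X (p - 1)) (p : ℤ) : Prop :=
  f.f p = M.d p (p + 1) ≫ η (p + 1) ≫ (K.XIsoOfEq (by omega : p + 1 - 1 = p)).hom +
    η p ≫ K.d (p - 1) p

omit [HasExt.{w} C] in
/-- The homotopy equation holds trivially in a degree where `Mᵖ = 0`. [folklore] -/
private theorem hEq'_of_isZero (η : ∀ p : ℤ, M.X p ⟶ K.X (p - 1)) (p : ℤ) (hp : IsZero (M.X p)) :
    HEq' f η p :=
  hp.eq_of_src _ _

/-- **One step down.** If the homotopy equations hold in all degrees `≥ m` for the family `η`, and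
`K` is acyclic, bounded below, with `Ext^{≥1}(Mᵐ⁻¹, Kⁿ) = 0`, then after changing `η` in degree
`m - 1` only, they hold in all degrees `≥ m - 1`: the defect `u = fᵐ⁻¹ - d ηᵐ` is a cycle of
`Hom(Mᵐ⁻¹, K•)`, hence a boundary (`exists_comp_d_eq_of_acyclic_of_ext_subsingleton`).
[cite: Hartshorne1977, III Prop. 1.2A (proof)] [cite: Weibel1994, Cor. 5.7.7] -/
private theorem hEq'_step (hK : ∀ n, K.ExactAt n) (a : ℤ) (ha : ∀ n, n < a → IsZero (K.X n))
    (p₀ : ℤ) (hX : ∀ (n : ℤ) (i : ℕ), 1 ≤ i → Subsingleton (Ext (M.X p₀) (K.X n) i))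
    (η : ∀ p : ℤ, M.X p ⟶ K.X (p - 1)) (hη : ∀ p, p₀ + 1 ≤ p → HEq' f η p) :
    ∃ η' : ∀ p : ℤ, M.X p ⟶ K.X (p - 1), ∀ p, p₀ ≤ p → HEq' f η' p := by
  classical
  -- the defect in degree `p₀`
  let u : M.X p₀ ⟶ K.X p₀ :=
    f.f p₀ - M.d p₀ (p₀ + 1) ≫ η (p₀ + 1) ≫ (K.XIsoOfEq (by omega : p₀ + 1 - 1 = p₀)).hom
  have hu : u ≫ K.d p₀ (p₀ + 1) = 0 := by
    have h1 : HEq' f η (p₀ + 1) := hη (p₀ + 1) le_rfl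
    dsimp only [HEq'] at h1
    have hcomm : f.f p₀ ≫ K.d p₀ (p₀ + 1) = M.d p₀ (p₀ + 1) ≫ f.f (p₀ + 1) := f.comm p₀ (p₀ + 1)
    simp only [u, Preadditive.sub_comp, Category.assoc, HomologicalComplex.XIsoOfEq_hom_comp_d, hcomm,
      h1, Preadditive.comp_add, HomologicalComplex.d_comp_d_assoc, zero_comp, zero_add, sub_self]
  obtain ⟨h, hh⟩ := exists_comp_d_eq_of_acyclic_of_ext_subsingleton (M.X p₀) K hK a ha hX
    (p₀ - 1) p₀ (p₀ + 1) (by omega) rfl u hu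
  refine ⟨Function.update η p₀ h, fun p hp => ?_⟩
  rcases eq_or_lt_of_le hp with rfl | hlt
  · -- the new equation in degree `p₀`
    dsimp only [HEq']
    rw [Function.update_self, Function.update_of_ne (by omega), hh]
    simp only [u, add_sub_cancel]
  · -- the old equations in degrees `> p₀` are untouched
    have h2 := hη p (by omega)
    dsimp only [HEq'] at h2 ⊢
    rw [Function.update_of_ne (by omega), Function.update_of_ne (by omega)]
    exact h2

/-- **Every chain map from a bounded complex `M•` to an acyclic bounded-below complex `K•` with
`Ext^{≥1}(Mᵖ, Kⁿ) = 0` is null-homotopic.** Descending induction: starting with `η = 0` above the top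
of `M•`, `hEq'_step` produces the null-homotopy one degree at a time; below the bottom of `M•` the
equations are empty. [cite: Hartshorne1977, III Prop. 1.2A] [cite: Weibel1994, Cor. 5.7.7 and Cor. 10.4.7] -/
theorem nullHomotopic_of_acyclic_of_ext_subsingleton (hK : ∀ n, K.ExactAt n) (a : ℤ)
    (ha : ∀ n, n < a → IsZero (K.X n)) (a₀ b₀ : ℤ) (hMa : ∀ p, p < a₀ → IsZero (M.X p))
    (hMb : ∀ p, b₀ ≤ p → IsZero (M.X p))
    (hX : ∀ (p n : ℤ) (i : ℕ), 1 ≤ i → Subsingleton (Ext (M.X p) (K.X n) i)) :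
    Nonempty (Homotopy f 0) := by
  -- the equations in degrees `≥ b₀ - k`, by induction on `k`
  have hind : ∀ k : ℕ, ∃ η : ∀ p : ℤ, M.X p ⟶ K.X (p - 1), ∀ p, b₀ - k ≤ p → HEq' f η p := by
    intro k
    induction k with
    | zero => exact ⟨fun _ => 0, fun p hp => hEq'_of_isZero f _ p (hMb p (by omega))⟩
    | succ k ih =>
      obtain ⟨η, hη⟩ := ih
      obtain ⟨η', hη'⟩ := hEq'_step f hK a ha (b₀ - (k + 1 : ℕ)) (hX _) η
        (fun p hp => hη p (by push_cast at hp ⊢; omega))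
      exact ⟨η', hη'⟩
  -- all equations at once
  obtain ⟨η, hη⟩ := hind (b₀ - a₀).toNat
  have hall : ∀ p, HEq' f η p := fun p => by
    by_cases hp : p < a₀
    · exact hEq'_of_isZero f η p (hMa p hp)
    · exact hη p (by omega)
  -- package as a degree `-1` cochain `z` with `δ z = f`
  let z : Cochain M K (-1) :=
    Cochain.mk fun p q hpq => η p ≫ (K.XIsoOfEq (by omega : p - 1 = q)).hom
  refine ⟨(Cochain.equivHomotopy f 0).symm ⟨z, ?_⟩⟩
  ext p
  rw [Cochain.add_v, Cochain.ofHom_v, Cochain.ofHom_v,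
    δ_v (-1) 0 (neg_add_cancel 1) z p p (add_zero p) (p - 1) (p + 1) rfl rfl]
  simp only [z, Cochain.mk_v, HomologicalComplex.zero_f, add_zero, Int.negOnePow_zero, one_smul,
    HomologicalComplex.XIsoOfEq_rfl, Iso.refl_hom, Category.comp_id]
  rw [add_comm]
  exact hall p

/-- **`Hom_{K(𝒜)}(M•, C•) = 0`** for `M•` bounded, `C•` acyclic bounded-below and `Ext^{≥1}(Mᵖ, Cⁿ) = 0`
(every class is represented by a chain map, which is null-homotopic).
[cite: Hartshorne1977, III Prop. 1.2A] [cite: Weibel1994, Cor. 10.4.7] -/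
theorem subsingleton_quotient_hom_of_acyclic_of_ext_subsingleton (hK : ∀ n, K.ExactAt n) (a : ℤ)
    (ha : ∀ n, n < a → IsZero (K.X n)) (a₀ b₀ : ℤ) (hMa : ∀ p, p < a₀ → IsZero (M.X p))
    (hMb : ∀ p, b₀ ≤ p → IsZero (M.X p))
    (hX : ∀ (p n : ℤ) (i : ℕ), 1 ≤ i → Subsingleton (Ext (M.X p) (K.X n) i)) :
    Subsingleton ((HomotopyCategory.quotient C (ComplexShape.up ℤ)).obj M ⟶
      (HomotopyCategory.quotient C (ComplexShape.up ℤ)).obj K) := by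
  refine subsingleton_of_forall_eq 0 fun φ => ?_
  obtain ⟨g, rfl⟩ := (HomotopyCategory.quotient C (ComplexShape.up ℤ)).map_surjective φ
  obtain ⟨h⟩ := nullHomotopic_of_acyclic_of_ext_subsingleton g hK a ha a₀ b₀ hMa hMb hX
  rw [HomotopyCategory.eq_of_homotopy _ _ h, Functor.map_zero]

/-- The same with the target SHIFTED: `Hom_{K(𝒜)}(M•, C•⟦j⟧) = 0` (the shift of `C•` is again acyclic,
bounded below, with the same terms). [cite: Weibel1994, Cor. 10.4.7] -/
theorem subsingleton_quotient_hom_shift_of_acyclic_of_ext_subsingleton (hK : ∀ n, K.ExactAt n)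
    (a : ℤ) (ha : ∀ n, n < a → IsZero (K.X n)) (a₀ b₀ : ℤ) (hMa : ∀ p, p < a₀ → IsZero (M.X p))
    (hMb : ∀ p, b₀ ≤ p → IsZero (M.X p))
    (hX : ∀ (p n : ℤ) (i : ℕ), 1 ≤ i → Subsingleton (Ext (M.X p) (K.X n) i)) (j : ℤ) :
    Subsingleton ((HomotopyCategory.quotient C (ComplexShape.up ℤ)).obj M ⟶
      ((HomotopyCategory.quotient C (ComplexShape.up ℤ)).obj K)⟦j⟧) := by
  rw [HomotopyCategory.shift_quotient_obj]
  have hKj : ∀ n, (K⟦j⟧).ExactAt n := by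
    rw [← HomotopyCategory.quotient_obj_mem_subcategoryAcyclic_iff_exactAt,
      ← HomotopyCategory.shift_quotient_obj,
      (HomotopyCategory.subcategoryAcyclic C).prop_shift_iff_of_isStableUnderShift]
    exact (HomotopyCategory.quotient_obj_mem_subcategoryAcyclic_iff_exactAt K).mpr hK
  exact subsingleton_quotient_hom_of_acyclic_of_ext_subsingleton (M := M) (K := K⟦j⟧)
    hKj (a - j) (fun n hn => ha (n + j) (by omega)) a₀ b₀ hMa hMb
    (fun p n i hi => hX p (n + j) i hi)

end NullHomotopic

/-! ### `Hom_K(M•, N•) = Hom_D(M•, N•)` for `M•` bounded and `N•` bounded-below with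
`Ext^{≥1}(Mᵖ, Nⁿ) = 0` -/

section QhBijective

variable [HasExt.{w} C] [HasDerivedCategory.{w'} C] [EnoughInjectives C]
  {M N : CochainComplex C ℤ}

omit [HasDerivedCategory.{w'} C] [EnoughInjectives C] in
/-- The cone of an injective resolution `ρ : N• → J•` has `Hom(Mᵖ, –)`-acyclic terms if `N•` does.
[cite: Weibel1994, Prop. 3.3.4 (2)] -/
theorem subsingleton_ext_mappingCone_X_of_injective {J : CochainComplex C ℤ} (ρ : N ⟶ J)
    [∀ n, Injective (J.X n)] (P : C)
    (hX : ∀ (n : ℤ) (i : ℕ), 1 ≤ i → Subsingleton (Ext P (N.X n) i)) (n : ℤ) (i : ℕ) (hi : 1 ≤ i) :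
    Subsingleton (Ext P ((mappingCone ρ).X n) i) := by
  obtain ⟨k, rfl⟩ := Nat.exists_eq_add_one_of_ne_zero (by omega : i ≠ 0)
  haveI := hX (n + 1) (k + 1) hi
  haveI : Subsingleton (Ext P (J.X n) (k + 1)) :=
    subsingleton_of_forall_eq 0 fun x => x.eq_zero_of_injective
  haveI : Subsingleton (Ext P (N.X (n + 1) ⊞ J.X n) (k + 1)) := subsingleton_ext_biprod _ _ _ _
  refine subsingleton_of_forall_eq 0 fun x => ?_
  let e : (mappingCone ρ).X n ≅ N.X (n + 1) ⊞ J.X n :=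
    HomologicalComplex.homotopyCofiber.XIsoBiprod ρ n (n + 1) rfl
  have hx : x = (x.comp (Ext.mk₀ e.hom) (add_zero _)).comp (Ext.mk₀ e.inv) (add_zero _) := by
    rw [Ext.comp_assoc_of_second_deg_zero, Ext.mk₀_comp_mk₀, e.hom_inv_id, Ext.comp_mk₀_id]
  rw [hx, Subsingleton.elim (x.comp (Ext.mk₀ e.hom) (add_zero _)) 0, Ext.zero_comp]

/-- **`Qh : Hom_{K(𝒜)}(M•, N•) → Hom_{D(𝒜)}(M•, N•)` is bijective** for `M•` bounded, `N•` bounded below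
and `Ext^{≥1}(Mᵖ, Nⁿ) = 0` for all `p`, `n` (in an abelian category with enough injectives): an
injective resolution `ρ : N• → J•` has an acyclic bounded-below cone with `Hom(Mᵖ, –)`-acyclic terms,
so `Hom_K(M•, Cone ρ⟦j⟧) = 0` and composition with `ρ` is a bijection `Hom_K(M•, N•) ≅ Hom_K(M•, J•)`
(long exact sequence of the cone triangle in `K(𝒜)`); and `Qh` is bijective on `Hom_K(M•, J•)`
(`J•` K-injective) with `Qh(ρ)` invertible.
[cite: Spaltenstein1988, Prop. 1.5] [cite: Lipman2009, Prop. 3.2.3] [cite: Hartshorne1977, III Prop. 6.5] -/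
theorem Qh_map_bijective_of_ext_subsingleton (a : ℤ) (hNa : ∀ n, n < a → IsZero (N.X n))
    (a₀ b₀ : ℤ) (hMa : ∀ p, p < a₀ → IsZero (M.X p)) (hMb : ∀ p, b₀ ≤ p → IsZero (M.X p))
    (hX : ∀ (p n : ℤ) (i : ℕ), 1 ≤ i → Subsingleton (Ext (M.X p) (N.X n) i)) :
    Function.Bijective (DerivedCategory.Qh.map :
      ((HomotopyCategory.quotient C (ComplexShape.up ℤ)).obj M ⟶
        (HomotopyCategory.quotient C (ComplexShape.up ℤ)).obj N) → _) := by
  let 𝒦 := HomotopyCategory.quotient C (ComplexShape.up ℤ)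
  -- an injective resolution `ρ : N → J` of the bounded-below complex `N`
  haveI : N.IsStrictlyGE a := (CochainComplex.isStrictlyGE_iff N a).mpr (fun i hi => hNa i hi)
  obtain ⟨J, ρ, hρ, hJ, hJa⟩ := CochainComplex.Plus.modelCategoryQuillen.exists_quasiIso_injective N a
  haveI : ∀ n, Injective (J.X n) := hJ
  haveI : J.IsKInjective := CochainComplex.isKInjective_of_injective J a
  -- its cone: acyclic, bounded below, with `Hom(Mᵖ, –)`-acyclic terms, so `Hom_K(M, Cone⟦j⟧) = 0`
  have hC : ∀ n, (mappingCone ρ).ExactAt n := (AcyclicClass.quasiIso_iff_acyclic_mappingCone ρ).mp hρ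
  have hCa : ∀ n, n < a - 1 → IsZero ((mappingCone ρ).X n) := fun n hn =>
    (mappingCone.isZero_X_iff ρ n).mpr
      ⟨N.isZero_of_isStrictlyGE a (n + 1) (by omega), J.isZero_of_isStrictlyGE a n (by omega)⟩
  have hCX : ∀ (p n : ℤ) (i : ℕ), 1 ≤ i → Subsingleton (Ext (M.X p) ((mappingCone ρ).X n) i) :=
    fun p n i hi => subsingleton_ext_mappingCone_X_of_injective ρ (M.X p) (hX p) n i hi
  have h0 : Subsingleton (𝒦.obj M ⟶ 𝒦.obj (mappingCone ρ)) :=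
    subsingleton_quotient_hom_of_acyclic_of_ext_subsingleton hC (a - 1) hCa a₀ b₀ hMa hMb hCX
  have h1 : Subsingleton (𝒦.obj M ⟶ (𝒦.obj (mappingCone ρ))⟦(-1 : ℤ)⟧) :=
    subsingleton_quotient_hom_shift_of_acyclic_of_ext_subsingleton hC (a - 1) hCa a₀ b₀ hMa hMb hCX _
  -- the cone triangle `N → J → Cone ρ → N⟦1⟧` is distinguished in `K(𝒜)`
  have hT := HomotopyCategory.mappingCone_triangleh_distinguished ρ
  -- (i) composition with `ρ` is a bijection `Hom_K(M, N) → Hom_K(M, J)`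
  let Φ : (𝒦.obj M ⟶ 𝒦.obj N) → (𝒦.obj M ⟶ 𝒦.obj J) := fun u => u ≫ 𝒦.map ρ
  have hΦ : Function.Bijective Φ := by
    constructor
    · intro u₁ u₂ h
      have hu : (u₁ - u₂) ≫ (mappingCone.triangleh ρ).mor₁ = 0 := by
        change (u₁ - u₂) ≫ 𝒦.map ρ = 0
        rw [Preadditive.sub_comp]
        exact sub_eq_zero.mpr h
      obtain ⟨g, hg⟩ := Triangle.coyoneda_exact₂ _ (inv_rot_of_distTriang _ hT) (u₁ - u₂) hu
      have hg0 : g = 0 := h1.elim _ _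
      rw [hg0, zero_comp] at hg
      exact sub_eq_zero.mp hg
    · intro w
      have hw : w ≫ (mappingCone.triangleh ρ).mor₂ = 0 := h0.elim _ _
      obtain ⟨u, hu⟩ := Triangle.coyoneda_exact₂ _ hT w hw
      exact ⟨u, hu.symm⟩
  -- (ii) `Qh` is bijective on `Hom_K(M, J)` (`J` is K-injective) and inverts `ρ`
  have hQJ := CochainComplex.IsKInjective.Qh_map_bijective (𝒦.obj M) J
  haveI : IsIso (DerivedCategory.Qh.map (𝒦.map ρ)) :=
    Localization.inverts DerivedCategory.Qh (HomotopyCategory.quasiIso C (ComplexShape.up ℤ)) _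
      ((HomotopyCategory.quotient_map_mem_quasiIso_iff ρ).mpr
        ((HomologicalComplex.mem_quasiIso_iff ρ).mpr hρ))
  let Ψ : (DerivedCategory.Qh.obj (𝒦.obj M) ⟶ DerivedCategory.Qh.obj (𝒦.obj J)) →
      (DerivedCategory.Qh.obj (𝒦.obj M) ⟶ DerivedCategory.Qh.obj (𝒦.obj N)) :=
    fun v => v ≫ inv (DerivedCategory.Qh.map (𝒦.map ρ))
  have hΨ : Function.Bijective Ψ := by
    refine Function.bijective_iff_has_inverse.mpr ⟨fun v => v ≫ DerivedCategory.Qh.map (𝒦.map ρ),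
      fun v => ?_, fun v => ?_⟩
    · simp [Ψ]
    · simp [Ψ]
  have heq : (DerivedCategory.Qh.map : (𝒦.obj M ⟶ 𝒦.obj N) → _) = Ψ ∘ DerivedCategory.Qh.map ∘ Φ := by
    funext u
    simp only [Function.comp_apply, Ψ, Φ, Functor.map_comp, Category.assoc, IsIso.hom_inv_id,
      Category.comp_id]
  rw [heq]
  exact hΨ.comp (hQJ.comp hΦ)

/-- **`Hom_{K(𝒜)}(M•, N•) ≃ₗ[𝕜] Hom_{D(𝒜)}(Q M•, Q N•)`** for `M•` bounded, `N•` bounded below and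
`Ext^{≥1}(Mᵖ, Nⁿ) = 0` — the `𝕜`-linear packaging of `Qh_map_bijective_of_ext_subsingleton` composed
with `quotient ⋙ Qh ≅ Q` (twin of the tree's `IsKInjective.homLinearEquivQ` with the K-injective
target replaced by a `Hom(M•, –)`-acyclic one). [cite: Spaltenstein1988, Prop. 1.5]
[cite: Lipman2009, Prop. 3.2.3] -/
def homLinearEquivQOfExtVanishing {𝕜 : Type*} [Ring 𝕜] [Linear 𝕜 C] (a : ℤ)
    (hNa : ∀ n, n < a → IsZero (N.X n)) (a₀ b₀ : ℤ) (hMa : ∀ p, p < a₀ → IsZero (M.X p))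
    (hMb : ∀ p, b₀ ≤ p → IsZero (M.X p))
    (hX : ∀ (p n : ℤ) (i : ℕ), 1 ≤ i → Subsingleton (Ext (M.X p) (N.X n) i)) :
    ((HomotopyCategory.quotient C (ComplexShape.up ℤ)).obj M ⟶
        (HomotopyCategory.quotient C (ComplexShape.up ℤ)).obj N) ≃ₗ[𝕜]
      (DerivedCategory.Q.obj M ⟶ DerivedCategory.Q.obj N) :=
  (LinearEquiv.ofBijective (DerivedCategory.Qh.mapLinearMap 𝕜)
      (Qh_map_bijective_of_ext_subsingleton a hNa a₀ b₀ hMa hMb hX)).trans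
    (Linear.homCongr 𝕜 ((DerivedCategory.quotientCompQhIso C).app M)
      ((DerivedCategory.quotientCompQhIso C).app N))

/-- `homLinearEquivQOfExtVanishing` on a representative: `[f] ↦ Q f`. [cite: Spaltenstein1988, Prop. 1.5] -/
theorem homLinearEquivQOfExtVanishing_quotient_map {𝕜 : Type*} [Ring 𝕜] [Linear 𝕜 C] (a : ℤ)
    (hNa : ∀ n, n < a → IsZero (N.X n)) (a₀ b₀ : ℤ) (hMa : ∀ p, p < a₀ → IsZero (M.X p))
    (hMb : ∀ p, b₀ ≤ p → IsZero (M.X p))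
    (hX : ∀ (p n : ℤ) (i : ℕ), 1 ≤ i → Subsingleton (Ext (M.X p) (N.X n) i)) (f : M ⟶ N) :
    homLinearEquivQOfExtVanishing (𝕜 := 𝕜) a hNa a₀ b₀ hMa hMb hX
        ((HomotopyCategory.quotient C _).map f) = DerivedCategory.Q.map f := by
  simp only [homLinearEquivQOfExtVanishing, LinearEquiv.trans_apply, LinearEquiv.ofBijective_apply,
    Functor.mapLinearMap_apply, Linear.homCongr_apply, Iso.app_inv, Iso.app_hom, Category.assoc]
  calc _ = (DerivedCategory.quotientCompQhIso C).inv.app M ≫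
      ((HomotopyCategory.quotient C (ComplexShape.up ℤ) ⋙ DerivedCategory.Qh).map f ≫
        (DerivedCategory.quotientCompQhIso C).hom.app N) := rfl
    _ = (DerivedCategory.quotientCompQhIso C).inv.app M ≫
      ((DerivedCategory.quotientCompQhIso C).hom.app M ≫ DerivedCategory.Q.map f) := by
        rw [(DerivedCategory.quotientCompQhIso C).hom.naturality]
    _ = DerivedCategory.Q.map f := by rw [Iso.inv_hom_id_app_assoc]

end QhBijective

end Literature.Algebra.Homology

end
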